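import Summits.RiemannHypothesis.RiemannHypothesis.Theses.CharacterSums
import Summits.RiemannHypothesis.RiemannHypothesis.Theorems.ConreyPositivity.Negative.ImitationCertificate

/-!
# RiemannHypothesis / CharacterSums — REFUTATION of the crux `ConreyPositivity` (stmt-RiemannHypothesis-16980)

Refutes `CharacterSums.ConreyPositivity` [refuted-misstated]: NOT every prime `q ≡ 3 (mod 8)` has
`f_q(x) = ∑_{n ≥ 1} (n/q) sin(2πnx)/n² ≥ 0` on `[0, 1/4]` (Conrey 2024, Conj. 1 ∩ hypothesis of Thm. 3;
the author himself doubts it "for all primes q ≡ 3 mod 8", §7).  **Witness.** `g` = the completely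
multiplicative `±1` function with `g(p) = +1` iff `p mod 4096 ∈ (2048, 4096)` (`g = λ` on `[1, 2048]`):
(1) `exists_prime_imitating` — CRT + quadratic reciprocity + Dirichlet (`Nat.forall_exists_prime_gt_and_zmodEq`)
give primes `q ≡ 3 (8)` with `(n/q) = g(n)` for `n ≤ M = 2^17`; (2) `cert` — ONE compiled interval
computation on the tree's verified engine `Literature.Analysis.ValidatedNumerics.FixedPointInterval`
(scale `2^48`, `e^{iθ}` boxes): `∑_{n ≤ M} g(n) sin(2πn/4096)/n² ≤ total/2^48 = -1.5167·10⁻⁵`; (3) tail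
`≤ ∑_{n > M} n⁻² ≤ 1/M = 7.63·10⁻⁶` (`sum_Ioc_inv_sq_le_sub`).  Hence `f_q(1/4096) < 0`.  (Mechanism: a
Granville–Soundararajan window flip of `λ` at the primes in `(X/2, X)` against Conrey's kernel at `x = 1/X`,
first found numerically by the idea card `imitation-cuts-both-ways`; re-derived and certified here.)
**Class / repair.** misstated: the `∀` over ALL primes `q ≡ 3 (8)` fails (through primes of size `≈ e^M`);
RH is untouched.  `C′` = Conrey's imitating-subsequence form `W`, which the witness misses: `∀ N : ℕ, ∃ q : ℕ,
q.Prime ∧ q % 8 = 3 ∧ N < q ∧ (∀ n : ℕ, 1 ≤ n → n ≤ N → jacobiSym (n : ℤ) q = ArithmeticFunction.liouville n) ∧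
∀ x : ℝ, 0 ≤ x → x ≤ 1 / 4 → 0 ≤ ∑' n : ℕ, (jacobiSym (n : ℤ) q : ℝ) * Real.sin (2 * Real.pi * n * x) / (n : ℝ) ^ 2`
(the assembly survives once `CharacterImitation` consumes `W`).  Every `∀ q` variant dies by the same flip:
`x ∈ [0, δ]` (redo at `X > 1/δ`; numerics for `X = 2048, 4096, 8192`), excluding finitely many `q` (Dirichlet
gives infinitely many witnesses), `q` imitating `λ` on a FIXED `[1, N]` (flip above `N`; here `g = λ` on
`[1, 2048]`).  barrier-candidate: ImitationCutsBothWays — a sign law over ALL characters of a Dirichlet-dense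
quadratic family inherits every completely multiplicative `±1` pattern on initial segments.
-/

set_option linter.dupNamespace false

namespace Summit.RiemannHypothesis.RiemannHypothesis.Theorems

open ConreyPositivityCert in
/-- Refutes `CharacterSums.ConreyPositivity` [refuted-misstated]: NOT every prime `q ≡ 3 (mod 8)` has
`f_q(x) = ∑ (n/q) sin(2πnx)/n² ≥ 0` on `[0, 1/4]`; witness: any prime `q ≡ 3 (mod 8)` whose Legendre symbol
imitates on `[1, 2^17]` the completely multiplicative pattern `g` (`= λ` flipped to `+1` at the primes
`p ≡ 2049 … 4095 (mod 4096)`) — such `q` exist by CRT + reciprocity + Dirichlet (`exists_prime_imitating`) —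
has `f_q(1/4096) ≤ total/2^48 + 1/M < 0` by the compiled interval certificate `cert`
(`total/2^48 = -1.5167·10⁻⁵`, `1/M = 7.63·10⁻⁶`).  Repaired statement `C′` = Conrey's imitating-subsequence
form `W` (module docstring), which the witness misses; every `∀ q` variant dies by the same window flip.
barrier-candidate: ImitationCutsBothWays. [folklore] -/
theorem CharacterSumsConreyPositivity_refuted :
    ¬ _root_.Summit.RiemannHypothesis.RiemannHypothesis.Theses.CharacterSums.ConreyPositivity := by
  intro h
  obtain ⟨q, hq, hq8, -, hJ⟩ := exists_prime_imitating M 0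
  have hpos := h q hq hq8 (1 / 4096) (by norm_num) (by norm_num)
  exact absurd hpos (not_le.mpr (tsum_neg_of_imitates hJ))

end Summit.RiemannHypothesis.RiemannHypothesis.Theorems
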